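import Summits.Parity.GeneralizedHardyLittlewood.Theses.LeeYangFibres
import Summits.Parity.GeneralizedHardyLittlewood.Theorems.LeeYangFibresCellsToRelativeDimOneCounts
import Literature.NumberTheory.Sieve.LinearEquationsInPrimesDimOne
import Literature.NumberTheory.Sieve.LinearEquationsInPrimesOneForm
import HarnessLib

/-!
# Crux `PrimeCellsRelative` (stmt-Parity-14112): convexity of `K` is load-bearing

Negative-side support (refuter cdisprove seat). `PrimeCellsRelative` is uniform over CONVEX bodies
`K ⊆ [-N, N]` (intervals). Here we record, sorry-free, that convexity cannot be dropped (nor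
weakened to mere measurability): the variant without `Convex ℝ K` (stated inline below; no
proposition is defined under `Summits/`) is false at `t = 1` for `ψ(n) = n` and the body
`K = [-N, N] ∖ {(p) : p prime}` — the box with the prime points deleted. The deleted set is
countable, so `β_∞ = vol((0, N] ∖ primes) = N` and the model is `β_∞ 𝔖 A₁(N)/N = A₁(N) ≍ N/log N`,
while the prime cell of `K` is EMPTY; the allowance `(A₁(N) + N/log N)/4` is too small by the prime
number theorem window (tree: `eventually_primeCounting_window`).

Moral for provers: the main term sees `K` only through its measure, the count through its lattice
points; convexity (one interval, `|#(K ∩ ℤ) − vol K| ≤ 1` on every segment) is what reconciles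
them, and any decomposition of `K` inside a proof must be into boundedly many intervals. This file
does NOT refute the crux.
-/

noncomputable section

namespace Summit.Parity.GeneralizedHardyLittlewood.Theorems.PrimeCellsRelative.Negative

open scoped BigOperators Topology Classical MeasureTheory
open Filter Set Function MeasureTheory Finset Literature.NumberTheory.Sieve
open Summit.Parity.GeneralizedHardyLittlewood.Theorems.LeeYangFibresCells
  (card_roughPrimes_le_primeCounting primeCounting_le_card_roughPrimes_add
    eventually_primeCounting_window)

namespace Convexity

/-- The archimedean factor of `ψ(n) = n` on the box with the prime points deleted is still `N`:
a countable set is Lebesgue-null. [folklore] -/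
theorem archFactor_id_puncturedBox (N : ℕ) :
    archFactor (fun _ : Fin 1 => (⟨fun _ => 1, 0⟩ : AffLinForm 1)) (realBox 1 (N : ℝ) \ {x : Fin 1 → ℝ | ∃ p : ℕ, p.Prime ∧ x = fun _ => (p : ℝ)}) = N := by
  rw [DimOne.archFactor_eq]
  have hset : {r : ℝ | (fun _ : Fin 1 => r) ∈
      realBox 1 (N : ℝ) \ {x : Fin 1 → ℝ | ∃ p : ℕ, p.Prime ∧ x = fun _ => (p : ℝ)} ∧
      ∀ _i : Fin 1, 0 < (⟨fun _ => 1, 0⟩ : AffLinForm 1).realEval (fun _ => r)} =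
        Set.Ioc 0 (N : ℝ) \ {r : ℝ | ∃ p : ℕ, p.Prime ∧ r = p} := by
    ext r
    simp only [Set.mem_setOf_eq, Set.mem_sdiff, realBox, Set.mem_Icc, Pi.le_def,
      DimOne.realEval_eq, Int.cast_one, one_mul, Int.cast_zero, add_zero, forall_const,
      Set.mem_Ioc]
    have hiff : (∃ p : ℕ, p.Prime ∧ (fun _ : Fin 1 => r) = fun _ => (p : ℝ)) ↔
        ∃ p : ℕ, p.Prime ∧ r = p := by
      constructor
      · rintro ⟨p, hp, h⟩
        exact ⟨p, hp, congr_fun h 0⟩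
      · rintro ⟨p, hp, h⟩
        exact ⟨p, hp, funext fun _ => h⟩
    rw [hiff]
    constructor
    · rintro ⟨⟨⟨-, h2⟩, h3⟩, h4⟩
      exact ⟨⟨h4, h2⟩, h3⟩
    · rintro ⟨⟨h1, h2⟩, h3⟩
      exact ⟨⟨⟨by linarith [Nat.cast_nonneg (α := ℝ) N], h2⟩, h3⟩, h1⟩
  have hnull : volume {r : ℝ | ∃ p : ℕ, p.Prime ∧ r = p} = 0 := by
    refine Set.Countable.measure_zero ?_ volume
    refine (Set.countable_range (Nat.cast : ℕ → ℝ)).mono ?_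
    rintro r ⟨p, -, rfl⟩
    exact ⟨p, rfl⟩
  rw [hset, measure_sdiff_null hnull, Real.volume_Ioc, ENNReal.toReal_ofReal (by simp)]
  simp

/-- The singular product of `ψ(n) = n` is `1`. [folklore] -/
theorem singularProduct_id :
    singularProduct (fun _ : Fin 1 => (⟨fun _ => 1, 0⟩ : AffLinForm 1)) = 1 := by
  rw [OneForm.singularProduct_eq _ (by simp)]
  simp

/-- The arithmetic heart for an EMPTY cell against a main term `c N · 1 · A₁(N)/N`, `c ≥ 1`, with
the two finsets of the statement abstracted (decidability instances met by unification).
[folklore] -/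
theorem finish_empty {N : ℕ} (hN : 2 ≤ N) {p : (Fin 1 → ℤ) → Prop} {hdec : DecidablePred p} {A : ℕ}
    {S β Z c : ℝ} (hc : 1 ≤ c)
    (hb : |(#((latticeBox 1 N).filter p) : ℝ) - β * S * ((A : ℝ) / N) ^ 1| ≤
      1 / 4 * (β * S * ((A : ℝ) / N) ^ 1 + N / Real.log N ^ 1))
    (hnone : ∀ x ∈ latticeBox 1 N, ¬ p x) (hβ : β = c * N) (hS : S = 1)
    (hlow : (Nat.primeCounting N : ℝ) ≤ A + Z) (hZ : Z ≤ Real.sqrt N) (hup : (A : ℝ) ≤ Nat.primeCounting N)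
    (hwin : ∀ A' : ℝ, (Nat.primeCounting N : ℝ) - Real.sqrt N ≤ A' → A' ≤ Nat.primeCounting N →
      (1 - 1 / 2) * N ≤ A' * Real.log N ∧ A' * Real.log N ≤ (1 + 1 / 2) * N) : False := by
  have hcount : (#((latticeBox 1 N).filter p) : ℝ) = 0 := by
    rw [Nat.cast_eq_zero, Finset.card_eq_zero, Finset.filter_eq_empty_iff]
    exact hnone
  rw [hcount, hβ, hS, pow_one, pow_one] at hb
  have hN0 : (0 : ℝ) < N := by exact_mod_cast (show 0 < N by omega)
  have hlog : 0 < Real.log N := Real.log_pos (by exact_mod_cast (show 1 < N by omega))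
  have h2 : c * (N : ℝ) * 1 * ((A : ℝ) / N) = c * A := by field_simp
  rw [h2, zero_sub, abs_neg, abs_of_nonneg (by positivity)] at hb
  have h6 : 3 * c * (A : ℝ) * Real.log N ≤ N := by
    have h' : 3 * c * (A : ℝ) ≤ N / Real.log N := by linarith
    have := mul_le_mul_of_nonneg_right h' hlog.le
    rwa [div_mul_cancel₀ _ hlog.ne'] at this
  have hw := (hwin A (by linarith) hup).1
  have hA : (A : ℝ) * Real.log N ≤ c * ((A : ℝ) * Real.log N) :=
    le_mul_of_one_le_left (by positivity) hc
  nlinarith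

end Convexity

open Convexity in
/-- **The convexity hypothesis of `PrimeCellsRelative` cannot be dropped.** Without it, at
`t = 1`, `L = 1`, `ε = 1/4`, the system `ψ(n) = n` (`𝔖 = 1`) and the punctured box
`K = [-N, N] ∖ {(p) : p prime} ⊆ [-N, N]` (Lebesgue-a.e. the box: `β_∞ = N`) have an EMPTY prime
cell against the model `β_∞ 𝔖 A₁(N)/N = A₁(N)`, and `A₁ ≤ (A₁ + N/log N)/4` contradicts
`A₁(N) log N ≥ N/2`. [folklore] -/
theorem primeCellsRelative_false_without_convexity :
    ¬ (∀ (t L : ℕ), 1 ≤ t → ∀ ε : ℝ, 0 < ε → ∃ u : ℕ, 2 ≤ u ∧ ∃ N₀ : ℕ, ∀ N : ℕ, N₀ ≤ N →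
      ∀ Ψ : Fin t → Literature.NumberTheory.Sieve.AffLinForm 1,
        Literature.NumberTheory.Sieve.IsNondegenerateSystem Ψ →
        Literature.NumberTheory.Sieve.affLinSize Ψ N ≤ L →
        ∀ K : Set (Fin 1 → ℝ), K ⊆ Literature.NumberTheory.Sieve.realBox 1 N →
          |((((Literature.NumberTheory.Sieve.latticeBox 1 N).filter (fun n =>
              Literature.NumberTheory.Sieve.realPoint n ∈ K ∧ ∀ i, (N : ℝ) ^ ((1 : ℝ) / u) <
                (Nat.minFac ((Ψ i).eval n).toNat : ℝ) ∧
                ArithmeticFunction.cardFactors ((Ψ i).eval n).toNat = 1)).card : ℕ) : ℝ) -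
            Literature.NumberTheory.Sieve.archFactor Ψ K *
              Literature.NumberTheory.Sieve.singularProduct Ψ *
              (((((Finset.Icc 1 N).filter (fun m => (N : ℝ) ^ ((1 : ℝ) / u) < (Nat.minFac m : ℝ) ∧
                ArithmeticFunction.cardFactors m = 1)).card : ℕ) : ℝ) / N) ^ t| ≤
          ε * (Literature.NumberTheory.Sieve.archFactor Ψ K *
              Literature.NumberTheory.Sieve.singularProduct Ψ *
              (((((Finset.Icc 1 N).filter (fun m => (N : ℝ) ^ ((1 : ℝ) / u) < (Nat.minFac m : ℝ) ∧
                ArithmeticFunction.cardFactors m = 1)).card : ℕ) : ℝ) / N) ^ t + N / Real.log N ^ t)) := by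
  intro h
  obtain ⟨u, hu2, N₀, hN₀⟩ := h 1 1 le_rfl (1 / 4) (by norm_num)
  obtain ⟨N₁, hN₁⟩ := Filter.eventually_atTop.mp
    (eventually_primeCounting_window (η := 1 / 2) (by norm_num))
  set N : ℕ := max (max N₀ N₁) 2 with hNdef
  have hN₀N : N₀ ≤ N := (le_max_left _ _).trans (le_max_left _ _)
  have hN₁N : N₁ ≤ N := (le_max_right _ _).trans (le_max_left _ _)
  have hN2 : 2 ≤ N := le_max_right _ _
  have hb := hN₀ N hN₀N (fun _ => ⟨fun _ => 1, 0⟩) ?_ ?_ (realBox 1 N \ {x : Fin 1 → ℝ | ∃ p : ℕ, p.Prime ∧ x = fun _ => (p : ℝ)})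
    Set.sdiff_subset
  · refine finish_empty hN2 le_rfl hb (fun x hx hpx => ?_) (by rw [one_mul]; exact archFactor_id_puncturedBox N)
      singularProduct_id
      (primeCounting_le_card_roughPrimes_add N (Real.rpow_nonneg (Nat.cast_nonneg N) _)) ?_
      (card_roughPrimes_le_primeCounting N _) (hN₁ N hN₁N)
    · -- a counted point would be a deleted prime point
      obtain ⟨hK, hall⟩ := hpx
      obtain ⟨-, hΩ⟩ := hall 0
      rw [ArithmeticFunction.cardFactors_eq_one_iff_prime, DimOne.eval_eq] at hΩ
      simp only [one_mul, add_zero] at hΩ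
      have hx0 : 0 ≤ x 0 := by
        by_contra hneg
        rw [Int.toNat_of_nonpos (by omega)] at hΩ
        exact Nat.not_prime_zero hΩ
      refine hK.2 ⟨(x 0).toNat, hΩ, funext fun j => ?_⟩
      rw [Fin.fin_one_eq_zero j]
      simp only [Literature.NumberTheory.Sieve.realPoint]
      have : ((x 0).toNat : ℤ) = x 0 := Int.toNat_of_nonneg hx0
      exact_mod_cast this.symm
    · -- `N^{1/u} ≤ √N`
      have hN1 : (1 : ℝ) ≤ (N : ℝ) := by exact_mod_cast (show 1 ≤ N by omega)
      have hu : (1 : ℝ) / u ≤ 1 / 2 := by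
        gcongr
        exact_mod_cast hu2
      calc (N : ℝ) ^ ((1 : ℝ) / u) ≤ (N : ℝ) ^ ((1 : ℝ) / 2) := Real.rpow_le_rpow_of_exponent_le hN1 hu
        _ = Real.sqrt N := by rw [Real.sqrt_eq_rpow]
  · refine ⟨fun i h0 => ?_, fun i j hij => absurd (Subsingleton.elim i j) hij⟩
    have := congr_fun h0 0
    simp at this
  · simp [Literature.NumberTheory.Sieve.affLinSize]

end Summit.Parity.GeneralizedHardyLittlewood.Theorems.PrimeCellsRelative.Negative

end
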